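import Summits.BirchSwinnertonDyer.BirchSwinnertonDyer.Theorems.ClassRecordThreeEulerHalvesAtThreeCartanTransportSplitResidue
import Literature.NumberTheory.Automorphic.BrandtModuleDictionary
import Literature.NumberTheory.Automorphic.BrandtOrderIdeals
import HarnessLib

/-!
# Cartan transport, brick X2a — the left order of the line ideal `M_ℓ ⊂ O₁` at `q`: maximality, membership, index `q`

Helper file for the crux `EulerHalvesAtThree` of route `ClassRecordThree` (node served: residue crux `EulerHalvesAtThreeResidualUpperBound`,
line `cartan`, item NUM := `CartanOnePlaceDegreeLawAtThree`, skeleton `Lines/lattice` v2, mixed input (P+T)), lane (α′) «the split sheet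
is a presentation of level `(D, Mq²; C∖q)`». Generic residue algebra for a `ℤ`-order `O₁` of a `ℚ`-algebra with a matrix residue map
`ψ₁` mod `q` (brick X1), the coordinate line `ℓ_k = 𝔽_q e_k ⊂ 𝔽_q²` (`k ≠ k'` the two indices) and the invertible right `O₁`-ideal
`I = M_{ℓ_k} = {y ∈ O₁ : ψ₁ y has columns in ℓ_k}` of the tree (`IsMatrixResidueMap.idealOf`, `ResidueSubidealCount`):
* §0 membership in `ℓ_k`, `J_{ℓ_k}` (row `k'` vanishes), `K_{ℓ_k}` (column `k` vanishes);
* §1 `isMaximalOrder_leftOrder_idealOf` — if `O₁` is maximal then so is `P := O_L(I)` (Voight 17.4.11 with the explicit inverse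
  `I' = q⁻¹ N_{ℓ_k}`: `I I' = P`, `I' I = O₁`; no division-algebra hypothesis);
* §2 `smul_mem_of_mem_leftOrder` (`q P ⊆ O₁`), `mem_leftOrder_iff_of_mem` (`P ∩ O₁ = {x ∈ O₁ : ψ₁ x k' k = 0}`),
  `apply_smul_eq_zero_of_mem_leftOrder` (for `x ∈ P`, `ψ₁ (q x)` has at most the entry `(k, k')`), `mem_O_of_mem_leftOrder`;
* §3 `relIndex_leftOrder` — **`[P : P ∩ O₁] = q`** (the map `x ↦ ψ₁(q x)_{k k'}` is onto `𝔽_q` with kernel `P ∩ O₁`).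
No definition is introduced; nothing is proved about NUM, (F2b♮) or any summit statement.
[cite: Voight2021, Lemma 17.4.11, 23.2.3, 23.4.3] [cite: VignerasLNM800, Ch. I §4 Lemme 4.10, Ch. II §2 Thm. 2.3]
-/

set_option linter.dupNamespace false
set_option autoImplicit false

open scoped MatrixGroups

namespace Summit.BirchSwinnertonDyer.BirchSwinnertonDyer.Theorems.CartanTransport.Split

open Literature.NumberTheory.Automorphic
open Summit.BirchSwinnertonDyer.BirchSwinnertonDyer.Theorems.CartanTransport

/-! ## §0 Lines and their matrix ideals in `M₂(F)` -/

section Lines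

variable {F : Type*} [Field F]

/-- PROVED — `v ∈ F e_k ↔ v_{k'} = 0` (`k ≠ k'`). -/
theorem mem_line_iff {k k' : Fin 2} (hkk' : k ≠ k') {v : Fin 2 → F} :
    v ∈ (F ∙ (Pi.single k (1 : F) : Fin 2 → F)) ↔ v k' = 0 := by
  rw [Submodule.mem_span_singleton]
  constructor
  · rintro ⟨a, rfl⟩
    simp [hkk'.symm]
  · intro h
    refine ⟨v k, funext fun i => ?_⟩
    fin_cases k <;> fin_cases k' <;> fin_cases i <;> simp_all

/-- PROVED — `A ∈ J_{ℓ_k}` (columns in `F e_k`) iff row `k'` of `A` vanishes. -/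
theorem mem_rightIdealOf_line_iff {k k' : Fin 2} (hkk' : k ≠ k') {A : Matrix (Fin 2) (Fin 2) F} :
    A ∈ MatrixRightIdeal.rightIdealOf (Fin 2) (F ∙ (Pi.single k (1 : F) : Fin 2 → F)) ↔ ∀ j, A k' j = 0 := by
  rw [MatrixRightIdeal.mem_rightIdealOf_iff_col]
  simp only [mem_line_iff hkk', Matrix.col_apply]

/-- PROVED — `A ∈ K_{ℓ_k}` (kills `F e_k`) iff column `k` of `A` vanishes. -/
theorem mem_leftAnnOf_line_iff {k : Fin 2} {A : Matrix (Fin 2) (Fin 2) F} :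
    A ∈ MatrixRightIdeal.leftAnnOf (Fin 2) (F ∙ (Pi.single k (1 : F) : Fin 2 → F)) ↔ ∀ i, A i k = 0 := by
  rw [MatrixRightIdeal.mem_leftAnnOf_iff]
  constructor
  · intro h i
    have := congrFun (h (Pi.single k 1) (Submodule.mem_span_singleton_self _)) i
    rwa [Matrix.mulVec_single_one] at this
  · intro h u hu
    obtain ⟨a, rfl⟩ := Submodule.mem_span_singleton.mp hu
    rw [Matrix.mulVec_smul, Matrix.mulVec_single_one]
    ext i
    simp [h i]

/-- PROVED — the matrix unit `E_{k k}` lies in `J_{ℓ_k}`. -/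
theorem single_mem_rightIdealOf_line {k k' : Fin 2} (hkk' : k ≠ k') (c : F) (j : Fin 2) :
    Matrix.single k j c ∈ MatrixRightIdeal.rightIdealOf (Fin 2) (F ∙ (Pi.single k (1 : F) : Fin 2 → F)) := by
  rw [mem_rightIdealOf_line_iff hkk']
  intro j'
  simp [hkk']

/-- PROVED — the matrix unit `E_{i k'}` lies in `K_{ℓ_k}`. -/
theorem single_mem_leftAnnOf_line {k k' : Fin 2} (hkk' : k ≠ k') (c : F) (i : Fin 2) :
    Matrix.single i k' c ∈ MatrixRightIdeal.leftAnnOf (Fin 2) (F ∙ (Pi.single k (1 : F) : Fin 2 → F)) := by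
  rw [mem_leftAnnOf_line_iff]
  intro i'
  simp [hkk'.symm]

/-- PROVED — row `k'` of `A E_{k k}`-type products: `(A * B) k' j = A k' k * B k j + A k' k' * B k' j`. -/
theorem mul_apply_two {k k' : Fin 2} (_hkk' : k ≠ k') (A B : Matrix (Fin 2) (Fin 2) F) (i j : Fin 2) :
    (A * B) i j = A i k * B k j + A i k' * B k' j := by
  rw [Matrix.mul_apply]
  fin_cases k <;> fin_cases k' <;> simp_all [Fin.sum_univ_two, add_comm]

end Lines

section Generic

variable {B : Type*} [Ring B] [Algebra ℚ B] {O₁ : Submodule ℤ B} {q : ℕ} [Fact q.Prime]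
  {ψ₁ : B → Matrix (Fin 2) (Fin 2) (ZMod q)}

/-! ## §1 The left order of `M_U` is maximal -/

/-- PROVED — **`O_L(M_U)` is a maximal order** when `O₁` is (Voight 17.4.11: orders connected by an invertible ideal; the inverse is the
tree's explicit `I' = q⁻¹ N_U` with `I I' = O_L(I)`, `I' I = O₁`). [cite: Voight2021, Lemma 17.4.11] [cite: VignerasLNM800, Ch. I §4 Lemme 4.10] -/
theorem isMaximalOrder_leftOrder_idealOf (h : IsMatrixResidueMap O₁ q ψ₁) (hO : Brandt.IsMaximalOrder B O₁)
    (U : Submodule (ZMod q) (Fin 2 → ZMod q)) : Brandt.IsMaximalOrder B (Brandt.leftOrder (h.idealOf U)) := by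
  haveI : IsAddTorsionFree B := isAddTorsionFree_of_charZero_module ℚ B
  have hq : q.Prime := Fact.out
  have hq0 : q ≠ 0 := hq.ne_zero
  have hOZ : IsZOrder O₁ := isZOrder_iff_isOrder.mpr hO.1
  set I := h.idealOf U with hIdef
  set Iinv := h.invOf U with hIinvdef
  have hIfull : IsFullLattice B I := h.isFullLattice_idealOf hOZ hq0 U
  have hIO : Brandt.rightOrder I = O₁ := by
    rw [← rightOrderOf_eq_rightOrder]
    exact h.rightOrderOf_idealOf hOZ hq0 U
  have h1 : I * Iinv = Brandt.leftOrder I := by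
    rw [← leftOrderOf_eq_leftOrder]
    exact h.idealOf_mul_invOf hOZ hq0 U
  have h3 : Iinv * I = O₁ := h.invOf_mul_idealOf hOZ hq0 U
  have hinvFG : Iinv.FG := by
    have hinj : Function.Injective (DistribSMul.toLinearMap ℤ B ((q : ℕ) : ℤ)) := fun x y hxy =>
      zsmul_right_cancel (by exact_mod_cast hq0) hxy
    refine Submodule.fg_of_fg_map_injective _ hinj ?_
    exact Submodule.FG.of_le (Submodule.FG.of_le hOZ.isFullLattice.1 (h.preim_le _)) (Submodule.map_comap_le _ _)
  refine ⟨Brandt.isOrder_leftOrder hIfull, fun O'' hO'' hle => ?_⟩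
  set L : Submodule ℤ B := Iinv * (O'' * I) with hLdef
  have hII : I * O₁ = I := by rw [← hIO]; exact Brandt.mul_rightOrder_self I
  have hOL : O₁ ≤ L := by
    rw [← h3, hLdef]
    calc Iinv * I = Iinv * (Brandt.leftOrder I * I) := by rw [Brandt.leftOrder_mul_self]
      _ ≤ Iinv * (O'' * I) := mul_le_mul' le_rfl (mul_le_mul' hle le_rfl)
  have hLL : L * L ≤ L := by
    have e : L * L = Iinv * ((O'' * Brandt.leftOrder I * O'') * I) := by
      rw [hLdef, ← h1]; simp only [mul_assoc]
    rw [e, hLdef]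
    refine mul_le_mul' le_rfl (mul_le_mul' ?_ le_rfl)
    calc O'' * Brandt.leftOrder I * O'' ≤ O'' * O'' * O'' := mul_le_mul' (mul_le_mul' le_rfl hle) le_rfl
      _ = O'' := by rw [hO''.mul_self, hO''.mul_self]
  have hLord : Brandt.IsOrder B L :=
    { one_mem := hOL hO.1.one_mem
      mul_mem := fun a ha b hb => hLL (Submodule.mul_mem_mul ha hb)
      isFullLattice := ⟨hinvFG.mul (hO''.isFullLattice.1.mul hIfull.1), fun d => by
        obtain ⟨n, hn, hnd⟩ := hO.1.isFullLattice.2 d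
        exact ⟨n, hn, hOL hnd⟩⟩ }
  have hL : L = O₁ := hO.2 L hLord hOL
  have key : Brandt.leftOrder I * O'' * Brandt.leftOrder I = Brandt.leftOrder I := by
    calc Brandt.leftOrder I * O'' * Brandt.leftOrder I = (I * Iinv) * O'' * (I * Iinv) := by rw [h1]
      _ = I * (Iinv * (O'' * I)) * Iinv := by simp only [mul_assoc]
      _ = I * O₁ * Iinv := by rw [← hLdef, hL]
      _ = Brandt.leftOrder I := by rw [hII, h1]
  refine le_antisymm (fun x hx => ?_) hle
  rw [← key]
  have : x = 1 * x * 1 := by rw [one_mul, mul_one]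
  rw [this]
  exact Submodule.mul_mem_mul (Submodule.mul_mem_mul (Brandt.one_mem_leftOrder I) hx) (Brandt.one_mem_leftOrder I)

/-! ## §2 The left order of the line ideal: membership -/

variable {k k' : Fin 2}

omit [Algebra ℚ B] in
/-- PROVED — `q • 1 ∈ M_{ℓ_k}`. -/
theorem smul_one_mem_idealOf (h : IsMatrixResidueMap O₁ q ψ₁) (h₁ : IsZOrder O₁) (U : Submodule (ZMod q) (Fin 2 → ZMod q)) :
    ((q : ℕ) : ℤ) • (1 : B) ∈ h.idealOf U :=
  ⟨O₁.smul_mem _ h₁.one_mem, by rw [h.map_smul_eq_zero h₁.one_mem]; exact Submodule.zero_mem _⟩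

omit [Algebra ℚ B] in
/-- PROVED — **`q O_L(M_U) ⊆ O₁`**: `q x = x (q 1) ∈ M_U ⊆ O₁`. -/
theorem smul_mem_of_mem_leftOrder (h : IsMatrixResidueMap O₁ q ψ₁) (h₁ : IsZOrder O₁) (U : Submodule (ZMod q) (Fin 2 → ZMod q))
    {x : B} (hx : x ∈ Brandt.leftOrder (h.idealOf U)) : ((q : ℕ) : ℤ) • x ∈ h.idealOf U := by
  have := hx _ (smul_one_mem_idealOf h h₁ U)
  rwa [mul_smul_comm, mul_one] at this

omit [Algebra ℚ B] in
/-- PROVED — **`O_L(M_{ℓ_k}) ∩ O₁ = {x ∈ O₁ : (ψ₁ x)_{k' k} = 0}`** (the stabiliser of the line `ℓ_k` mod `q`). -/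
theorem mem_leftOrder_iff_of_mem (h : IsMatrixResidueMap O₁ q ψ₁) (h₁ : IsZOrder O₁) (hkk' : k ≠ k') {x : B} (hx : x ∈ O₁) :
    x ∈ Brandt.leftOrder (h.idealOf (ZMod q ∙ (Pi.single k (1 : ZMod q) : Fin 2 → ZMod q))) ↔ ψ₁ x k' k = 0 := by
  constructor
  · intro hP
    obtain ⟨y, hy, hψy⟩ := h.surj (Matrix.single k k 1)
    have hyI : y ∈ h.idealOf (ZMod q ∙ (Pi.single k (1 : ZMod q) : Fin 2 → ZMod q)) :=
      ⟨hy, by rw [hψy]; exact single_mem_rightIdealOf_line hkk' 1 k⟩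
    have hxy := (hP y hyI).2
    rw [h.map_mul _ hx _ hy, hψy, Submodule.mem_toAddSubgroup, mem_rightIdealOf_line_iff hkk'] at hxy
    have := hxy k
    simpa [Matrix.single_apply, hkk'] using this
  · intro h0 y hy
    refine ⟨h₁.mul_mem _ hx _ hy.1, ?_⟩
    have hyrow := (mem_rightIdealOf_line_iff hkk').mp hy.2
    rw [h.map_mul _ hx _ hy.1, Submodule.mem_toAddSubgroup, mem_rightIdealOf_line_iff hkk']
    intro j
    rw [mul_apply_two hkk', h0, hyrow j, zero_mul, mul_zero, add_zero]

omit [Algebra ℚ B] in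
/-- PROVED — for `x ∈ O_L(M_{ℓ_k})` the residue `ψ₁ (q x)` has vanishing row `k'` and vanishing entry `(k, k)` (only the entry `(k, k')`
may survive: `q O_L(I) = I · N_{ℓ_k}` reduces into the nilpotent line `J_{ℓ_k} K_{ℓ_k}`). -/
theorem apply_smul_eq_zero_of_mem_leftOrder (h : IsMatrixResidueMap O₁ q ψ₁) (h₁ : IsZOrder O₁) (hkk' : k ≠ k') {x : B}
    (hx : x ∈ Brandt.leftOrder (h.idealOf (ZMod q ∙ (Pi.single k (1 : ZMod q) : Fin 2 → ZMod q)))) :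
    (∀ j, ψ₁ (((q : ℕ) : ℤ) • x) k' j = 0) ∧ ψ₁ (((q : ℕ) : ℤ) • x) k k = 0 := by
  have hqx := smul_mem_of_mem_leftOrder h h₁ _ hx
  refine ⟨(mem_rightIdealOf_line_iff hkk').mp hqx.2, ?_⟩
  obtain ⟨y, hy, hψy⟩ := h.surj (Matrix.single k k 1)
  have hyI : y ∈ h.idealOf (ZMod q ∙ (Pi.single k (1 : ZMod q) : Fin 2 → ZMod q)) :=
    ⟨hy, by rw [hψy]; exact single_mem_rightIdealOf_line hkk' 1 k⟩
  have hxy : x * y ∈ O₁ := (hx y hyI).1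
  have h0 : ψ₁ (((q : ℕ) : ℤ) • x * y) = 0 := by
    rw [smul_mul_assoc]
    exact h.map_smul_eq_zero hxy
  rw [h.map_mul _ hqx.1 _ hy, hψy] at h0
  have := congrFun (congrFun h0 k) k
  rwa [Matrix.mul_single_apply_same, mul_one, Matrix.zero_apply] at this

/-- PROVED — an element of `O_L(M_{ℓ_k})` whose residue entry `(k, k')` of `ψ₁ (q x)` also vanishes lies in `O₁`. -/
theorem mem_of_mem_leftOrder_of_apply_eq_zero (h : IsMatrixResidueMap O₁ q ψ₁) (h₁ : IsZOrder O₁) (hkk' : k ≠ k') {x : B}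
    (hx : x ∈ Brandt.leftOrder (h.idealOf (ZMod q ∙ (Pi.single k (1 : ZMod q) : Fin 2 → ZMod q))))
    (h0 : ψ₁ (((q : ℕ) : ℤ) • x) k k' = 0) : x ∈ O₁ := by
  have hq : q.Prime := Fact.out
  have hqx := smul_mem_of_mem_leftOrder h h₁ _ hx
  obtain ⟨hrow, hkk⟩ := apply_smul_eq_zero_of_mem_leftOrder h h₁ hkk' hx
  have hzero : ψ₁ (((q : ℕ) : ℤ) • x) = 0 := by
    ext i j
    rw [Matrix.zero_apply]
    fin_cases k <;> fin_cases k' <;>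
      first
        | exact absurd rfl hkk'
        | (fin_cases i <;> fin_cases j <;> first | exact hrow _ | exact h0 | exact hkk)
  obtain ⟨x₁, hx₁, he⟩ := (h.ker _ hqx.1).mp hzero
  have : x = x₁ := zsmul_right_cancel (by exact_mod_cast hq.ne_zero) he
  exact this ▸ hx₁

/-! ## §3 The index `[O_L(M_{ℓ_k}) : O_L(M_{ℓ_k}) ∩ O₁] = q` -/

/-- PROVED — **`[O_L(I) : O_L(I) ∩ O₁] = q`** for `I = M_{ℓ_k}`: with `A = {x ∈ O₁ : (ψ₁ x)_{k' k} = 0} = O_L(I) ∩ O₁`, the additive map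
`x ↦ (ψ₁ (q x))_{k k'}` on `O_L(I)` is onto `𝔽_q` (value `c` at `y · q⁻¹ u` with `ψ₁ y = E_{kk}`, `ψ₁ u = c E_{kk'}`) with kernel `A`.
[cite: Voight2021, 23.4.3] -/
theorem relIndex_leftOrder (h : IsMatrixResidueMap O₁ q ψ₁) (h₁ : IsZOrder O₁) (hkk' : k ≠ k') :
    (h.preim (Matrix.entryAddMonoidHom (ZMod q) k' k).ker).toAddSubgroup.relIndex
      (Brandt.leftOrder (h.idealOf (ZMod q ∙ (Pi.single k (1 : ZMod q) : Fin 2 → ZMod q)))).toAddSubgroup = q := by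
  classical
  have hq : q.Prime := Fact.out
  have hq0 : q ≠ 0 := hq.ne_zero
  set U : Submodule (ZMod q) (Fin 2 → ZMod q) := ZMod q ∙ (Pi.single k (1 : ZMod q) : Fin 2 → ZMod q) with hU
  set P := Brandt.leftOrder (h.idealOf U) with hPdef
  have hqP : ∀ x ∈ P, ((q : ℕ) : ℤ) • x ∈ O₁ := fun x hx => (smul_mem_of_mem_leftOrder h h₁ U hx).1
  let Φ : P.toAddSubgroup →+ ZMod q :=
    { toFun := fun x => ψ₁ (((q : ℕ) : ℤ) • (x : B)) k k'
      map_zero' := by simp [h.map_zero]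
      map_add' := fun x y => by
        simp only [AddSubgroup.coe_add, smul_add]
        rw [h.map_add _ (hqP _ x.2) _ (hqP _ y.2), Matrix.add_apply] }
  have hΦ : ∀ x : P.toAddSubgroup, Φ x = ψ₁ (((q : ℕ) : ℤ) • (x : B)) k k' := fun _ => rfl
  -- `Φ` is onto
  have hsurj : Function.Surjective Φ := by
    intro c
    obtain ⟨y, hy, hψy⟩ := h.surj (Matrix.single k k 1)
    obtain ⟨u, hu, hψu⟩ := h.surj (Matrix.single k k' c)
    have hyI : y ∈ h.idealOf U := ⟨hy, by rw [hψy]; exact single_mem_rightIdealOf_line hkk' 1 k⟩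
    have hu' : (q : ℚ)⁻¹ • u ∈ h.invOf U := by
      rw [h.mem_invOf_iff, IsMatrixResidueMap.zsmul_inv_smul hq0]
      exact ⟨hu, by rw [hψu]; exact single_mem_leftAnnOf_line hkk' c k⟩
    have hx : y * ((q : ℚ)⁻¹ • u) ∈ P := by
      have := Submodule.mul_mem_mul hyI hu'
      rwa [h.idealOf_mul_invOf h₁ hq0, leftOrderOf_eq_leftOrder] at this
    refine ⟨⟨y * ((q : ℚ)⁻¹ • u), hx⟩, ?_⟩
    rw [hΦ]
    change ψ₁ (((q : ℕ) : ℤ) • (y * ((q : ℚ)⁻¹ • u))) k k' = c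
    rw [← mul_smul_comm, IsMatrixResidueMap.zsmul_inv_smul hq0, h.map_mul _ hy _ hu, hψy, hψu, Matrix.single_mul_single_same,
      one_mul, Matrix.single_apply_same]
  -- `ker Φ = A`
  have hker : (AddSubgroup.comap Φ ⊥) =
      (h.preim (Matrix.entryAddMonoidHom (ZMod q) k' k).ker).toAddSubgroup.addSubgroupOf P.toAddSubgroup := by
    ext x
    rw [AddSubgroup.mem_comap, AddSubgroup.mem_bot, hΦ, AddSubgroup.mem_addSubgroupOf, Submodule.mem_toAddSubgroup,
      IsMatrixResidueMap.mem_preim_iff, AddMonoidHom.mem_ker, Matrix.entryAddMonoidHom_apply]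
    constructor
    · intro h0
      have hxO : (x : B) ∈ O₁ := mem_of_mem_leftOrder_of_apply_eq_zero h h₁ hkk' x.2 h0
      exact ⟨hxO, (mem_leftOrder_iff_of_mem h h₁ hkk' hxO).mp x.2⟩
    · rintro ⟨hxO, -⟩
      rw [h.map_smul_eq_zero hxO, Matrix.zero_apply]
  rw [AddSubgroup.relIndex, ← hker, AddSubgroup.index_comap_of_surjective _ hsurj, AddSubgroup.index_bot, Nat.card_zmod]

end Generic

end Summit.BirchSwinnertonDyer.BirchSwinnertonDyer.Theorems.CartanTransport.Split
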